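import Summits.CriticalPhenomena.CardyFormulaZ2.Theorems.CardyUniqueLimitCardyRigidityMartingaleOfDataFlow
import HarnessLib

/-!
# The level-stopped crossing observable as a functional on driving-path space (line `crossing-martingale`, crux `CardyRigidity`)

Second helper file of stub `stub_martingaleOfData` (passage of the crossing-martingale property
to a scaling limit; crux `CardyRigidity`, stmt-CriticalPhenomena-0746; vocabulary of
`Theorems/CardyUniqueLimitCardyRigidityDefs.lean`).  The discrete martingale data of the stub
approximate the level-stopped crossing observable of the CANONICAL process `w ↦ (r ↦ w r)` on
`C([0, ∞), ℝ)` at the (sign-reversed) discrete driving paths, which need not start at `0`; the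
passage theorem `Loewner.integral_cylinder_eq_zero_of_discreteMartingales_of_ae_continuousAt`
wants a functional that is measurable in the path, continuous in time along EVERY path and
bounded.  This file builds it:

* `exists_clamp_kernel`, `crossingObs_eq_of_clamp_pt` — a kernel `g` continuous on `(0,1)` is
  replaced by a continuous bounded `ĝ` agreeing with `g` on every stopped modulus of every path
  started in the window `x₀ - M < w 0 < x₀ - m`;
* the START-CLIPPED path `w - (w 0 - clip_{[-δ,δ]}(w 0))` — the path translated to start at its
  initial value clipped to `[-δ, δ]` (`= w` when `|w 0| ≤ δ`); for small `δ` every clipped path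
  starts in the window, so that
* `measurable_crossingObs_cutStart` (via `MartingaleOfData.measurable_etaProc_stopped'`),
  `continuous_crossingObs_time_pt` and `abs_crossingObs_le_of_bound` give the three sure
  regularity properties of the functional `N_u(w) = crossingObs ĝ (canonical) x m M d u (clipped w)`;
* `crossingObs_congr_path` — the observable depends on the sample only through the driving path;
* `eventually_forall_abs_sub_lt_of_continuousAt` — uniform closeness on a compact time interval
  from joint continuity;
* `exists_antitone_seq_notMem`, `exists_monotone_seq_notMem` — inner levels avoiding a countable
  set of bad levels.
-/

noncomputable section

open MeasureTheory Filter Set Topology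
open scoped NNReal ENNReal
open Literature.Probability.RandomPlanarGeometry
open Literature.Probability.Process (exitTime coe_untopA_min_le continuous_untopA_min_coe)

namespace Summit.CriticalPhenomena.CardyFormulaZ2.Cruxes.CardyRigidity.CrossingMartingale

namespace MartingaleOfData

variable {x : Fin 3 → ℝ} {m M d : ℝ}

/-! ### A bounded continuous kernel agreeing with `g` on all stopped moduli -/

/-- **Clamping the kernel.**  For `g` continuous on `(0,1)` and admissible `(x; m, M, d)` there is a
continuous bounded `ĝ : ℝ → ℝ` agreeing with `g` on a compact interval `[k₁, k₂] ⊂ (0,1)` which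
contains the modulus `cardyEta a (a+g₁) (a+g₁+g₂)` of every point `(a, g₁, g₂)` of the level box
`[m, M] × [d, G] × [d, G]`, `G = x₂ - x₀ + 1`. [folklore] -/
theorem exists_clamp_kernel {g : ℝ → ℝ} (hg : ContinuousOn g (Ioo 0 1)) (h : AdmissibleLevels x m M d) :
    ∃ ĝ : ℝ → ℝ, Continuous ĝ ∧ (∃ B : ℝ, ∀ y, |ĝ y| ≤ B) ∧ ∃ k₁ k₂ : ℝ, EqOn ĝ g (Icc k₁ k₂) ∧
      ∀ a g₁ g₂ : ℝ, a ∈ Icc m M → g₁ ∈ Icc d (x 2 - x 0 + 1) → g₂ ∈ Icc d (x 2 - x 0 + 1) →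
        cardyEta a (a + g₁) (a + g₁ + g₂) ∈ Icc k₁ k₂ := by
  set G : ℝ := x 2 - x 0 + 1 with hG
  set Φ : ℝ × ℝ × ℝ → ℝ := fun p ↦ cardyEta p.1 (p.1 + p.2.1) (p.1 + p.2.1 + p.2.2) with hΦ
  set box : Set (ℝ × ℝ × ℝ) := Icc m M ×ˢ Icc d G ×ˢ Icc d G with hbox
  have hpos : ∀ p ∈ box, 0 < p.1 ∧ 0 < p.2.1 ∧ 0 < p.2.2 := by
    rintro p ⟨hp0, hp1, hp2⟩
    exact ⟨h.m_pos.trans_le hp0.1, h.d_pos.trans_le hp1.1, h.d_pos.trans_le hp2.1⟩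
  have hΦc : ContinuousOn Φ box := by
    intro p hp
    obtain ⟨h1, h2, h3⟩ := hpos p hp
    refine ContinuousAt.continuousWithinAt ?_
    have hden : (p.1 + p.2.1) * (p.1 + p.2.1 + p.2.2 - p.1) ≠ 0 := by
      have hA : 0 < p.1 + p.2.1 := by linarith
      have hB : 0 < p.1 + p.2.1 + p.2.2 - p.1 := by linarith
      exact (mul_pos hA hB).ne'
    simp only [hΦ, cardyEta]
    refine ContinuousAt.div ?_ ?_ hden
    · exact continuousAt_fst.mul
        ((continuousAt_fst.add (continuousAt_fst.comp continuousAt_snd)).add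
          (continuousAt_snd.comp continuousAt_snd) |>.sub
          (continuousAt_fst.add (continuousAt_fst.comp continuousAt_snd)))
    · exact (continuousAt_fst.add (continuousAt_fst.comp continuousAt_snd)).mul
        (((continuousAt_fst.add (continuousAt_fst.comp continuousAt_snd)).add
          (continuousAt_snd.comp continuousAt_snd)).sub continuousAt_fst)
  have hΦmem : ∀ p ∈ box, Φ p ∈ Ioo (0 : ℝ) 1 := by
    intro p hp
    obtain ⟨h1, h2, h3⟩ := hpos p hp
    exact cardyEta_mem_Ioo h1 (by linarith) (by linarith)
  set K : Set ℝ := Φ '' box with hK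
  have hKc : IsCompact K :=
    (isCompact_Icc.prod (isCompact_Icc.prod isCompact_Icc)).image_of_continuousOn hΦc
  have hKsub : K ⊆ Ioo 0 1 := by
    rintro _ ⟨p, hp, rfl⟩; exact hΦmem p hp
  have hx01 : x 0 < x 1 := h.strictMono (by decide)
  have hx12 : x 1 < x 2 := h.strictMono (by decide)
  have hKne : K.Nonempty := ⟨Φ (x 0, x 1 - x 0, x 2 - x 1), (x 0, x 1 - x 0, x 2 - x 1),
    ⟨⟨h.m_lt.le, h.lt_M.le⟩, ⟨h.d_lt₁.le, by rw [hG]; linarith⟩, ⟨h.d_lt₂.le, by rw [hG]; linarith⟩⟩,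
    rfl⟩
  obtain ⟨k₁, hk₁K, hk₁⟩ := hKc.exists_isLeast hKne
  obtain ⟨k₂, hk₂K, hk₂⟩ := hKc.exists_isGreatest hKne
  have hk₁pos : 0 < k₁ := (hKsub hk₁K).1
  have hk₂lt : k₂ < 1 := (hKsub hk₂K).2
  have hk₁₂ : k₁ ≤ k₂ := hk₁ hk₂K
  set cl : ℝ → ℝ := fun y ↦ max k₁ (min y k₂) with hcl
  have hclc : Continuous cl := continuous_const.max (continuous_id.min continuous_const)
  have hclmem : ∀ y, cl y ∈ Icc k₁ k₂ := fun y ↦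
    ⟨le_max_left _ _, max_le hk₁₂ (min_le_right _ _)⟩
  have hclIoo : ∀ y, cl y ∈ Ioo (0 : ℝ) 1 := fun y ↦
    ⟨hk₁pos.trans_le (hclmem y).1, (hclmem y).2.trans_lt hk₂lt⟩
  have hclI : ∀ y ∈ Icc k₁ k₂, cl y = y := fun y hy ↦ by
    rw [hcl]
    simp only
    rw [min_eq_left hy.2, max_eq_right hy.1]
  refine ⟨g ∘ cl, hg.comp_continuous hclc hclIoo, ?_, k₁, k₂, fun y hy ↦ ?_, fun a g₁ g₂ ha hg₁ hg₂ ↦ ?_⟩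
  · obtain ⟨B, hB⟩ := (isCompact_Icc (a := k₁) (b := k₂)).exists_bound_of_continuousOn
      (hg.mono fun y hy ↦ ⟨hk₁pos.trans_le hy.1, hy.2.trans_lt hk₂lt⟩)
    refine ⟨B, fun y ↦ ?_⟩
    have := hB (cl y) (hclmem y)
    rwa [Real.norm_eq_abs] at this
  · show g (cl y) = g y
    rw [hclI y hy]
  · have hmem : Φ (a, g₁, g₂) ∈ K := ⟨(a, g₁, g₂), ⟨ha, hg₁, hg₂⟩, rfl⟩
    exact ⟨hk₁ hmem, hk₂ hmem⟩

/-- **The clamped kernel gives the same level-stopped crossing observable** along every continuous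
driving path started in the window `x₀ - M < W 0 < x₀ - m`. [folklore] -/
theorem crossingObs_eq_of_clamp_pt {g ĝ : ℝ → ℝ} {k₁ k₂ : ℝ} (heq : EqOn ĝ g (Icc k₁ k₂))
    (hbox : ∀ a g₁ g₂ : ℝ, a ∈ Icc m M → g₁ ∈ Icc d (x 2 - x 0 + 1) → g₂ ∈ Icc d (x 2 - x 0 + 1) →
      cardyEta a (a + g₁) (a + g₁ + g₂) ∈ Icc k₁ k₂)
    {Ω : Type*} {W : Ω → ℝ≥0 → ℝ} {ω : Ω} (hc : Continuous (W ω)) (h : AdmissibleLevels x m M d)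
    (hw : W ω 0 ∈ Ioo (x 0 - M) (x 0 - m)) (t : ℝ≥0) :
    crossingObs ĝ W x m M d t ω = crossingObs g W x m M d t ω := by
  set τ : ℝ≥0 := (min (t : WithTop ℝ≥0) (levelTime W x m M d ω)).untopA with hτdef
  have hτρ : (τ : WithTop ℝ≥0) ≤ levelTime W x m M d ω := coe_untopA_min_le t _
  obtain ⟨hX0, hg1, hg2⟩ := marks_mem_box_pt hc h hw hτρ
  have hη : etaProc W x τ ω = cardyEta (markFlow W (x 0) τ ω)
      (markFlow W (x 0) τ ω + (markFlow W (x 1) τ ω - markFlow W (x 0) τ ω))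
      (markFlow W (x 0) τ ω + (markFlow W (x 1) τ ω - markFlow W (x 0) τ ω) +
        (markFlow W (x 2) τ ω - markFlow W (x 1) τ ω)) := by
    simp only [etaProc]
    congr 1 <;> ring
  have hηI : etaProc W x τ ω ∈ Icc k₁ k₂ := by
    rw [hη]
    exact hbox _ _ _ hX0 hg1 hg2
  show ĝ (etaProc W x τ ω) = g (etaProc W x τ ω)
  exact heq hηI

/-! ### The observable depends on the sample only through the driving path -/

/-- Hitting times depend on the process only through the path at the given sample point.
[folklore] -/
theorem hittingAfter_congr_path {ι β Ω₁ Ω₂ : Type*} [Preorder ι] [InfSet ι]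
    {u₁ : ι → Ω₁ → β} {u₂ : ι → Ω₂ → β} {ω₁ : Ω₁} {ω₂ : Ω₂} (hu : ∀ j, u₁ j ω₁ = u₂ j ω₂)
    (s : Set β) (n : ι) : hittingAfter u₁ s n ω₁ = hittingAfter u₂ s n ω₂ := by
  classical
  simp only [hittingAfter, hu]

/-- Level times depend on the driving process only through the driving path. [folklore] -/
theorem levelTime_congr_path {Ω₁ Ω₂ : Type*} {W₁ : Ω₁ → ℝ≥0 → ℝ} {W₂ : Ω₂ → ℝ≥0 → ℝ}
    {ω₁ : Ω₁} {ω₂ : Ω₂} (hW : W₁ ω₁ = W₂ ω₂) (x : Fin 3 → ℝ) (m M d : ℝ) :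
    levelTime W₁ x m M d ω₁ = levelTime W₂ x m M d ω₂ := by
  have hmk : ∀ (y : ℝ) (j : ℝ≥0), markFlow W₁ y j ω₁ = markFlow W₂ y j ω₂ := by
    intro y j
    show Loewner.realFlowStop (W₁ ω₁) y j = Loewner.realFlowStop (W₂ ω₂) y j
    rw [hW]
  simp only [levelTime, exitTime]
  rw [hittingAfter_congr_path (u₁ := markFlow W₁ (x 0)) (u₂ := markFlow W₂ (x 0)) (hmk (x 0)),
    hittingAfter_congr_path (u₁ := fun t ω ↦ markFlow W₁ (x 1) t ω - markFlow W₁ (x 0) t ω)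
      (u₂ := fun t ω ↦ markFlow W₂ (x 1) t ω - markFlow W₂ (x 0) t ω) (ω₁ := ω₁) (ω₂ := ω₂)
      (fun j ↦ by simp only [hmk]),
    hittingAfter_congr_path (u₁ := fun t ω ↦ markFlow W₁ (x 2) t ω - markFlow W₁ (x 1) t ω)
      (u₂ := fun t ω ↦ markFlow W₂ (x 2) t ω - markFlow W₂ (x 1) t ω) (ω₁ := ω₁) (ω₂ := ω₂)
      (fun j ↦ by simp only [hmk])]

/-- **Level-stopped crossing observables depend on the driving process only through the driving
path.** [folklore] -/
theorem crossingObs_congr_path {Ω₁ Ω₂ : Type*} {W₁ : Ω₁ → ℝ≥0 → ℝ} {W₂ : Ω₂ → ℝ≥0 → ℝ}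
    {ω₁ : Ω₁} {ω₂ : Ω₂} (hW : W₁ ω₁ = W₂ ω₂) (g : ℝ → ℝ) (x : Fin 3 → ℝ) (m M d : ℝ)
    (u : ℝ≥0) : crossingObs g W₁ x m M d u ω₁ = crossingObs g W₂ x m M d u ω₂ := by
  have hmk : ∀ (y : ℝ) (j : ℝ≥0), markFlow W₁ y j ω₁ = markFlow W₂ y j ω₂ := by
    intro y j
    show Loewner.realFlowStop (W₁ ω₁) y j = Loewner.realFlowStop (W₂ ω₂) y j
    rw [hW]
  show g (etaProc W₁ x ((min (u : WithTop ℝ≥0) (levelTime W₁ x m M d ω₁)).untopA) ω₁) =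
    g (etaProc W₂ x ((min (u : WithTop ℝ≥0) (levelTime W₂ x m M d ω₂)).untopA) ω₂)
  rw [levelTime_congr_path hW]
  simp only [etaProc, hmk]

/-- The crossing functional of the canonical process at the path of `W ω` is the crossing observable
of the process `W` at `ω`. [folklore] -/
theorem crossingObs_path_eq {Ω : Type*} {W : Ω → ℝ≥0 → ℝ} (hWc : ∀ ω, Continuous (W ω))
    (g : ℝ → ℝ) (x : Fin 3 → ℝ) (m M d : ℝ) (u : ℝ≥0) (ω : Ω) :
    crossingObs g (fun (w : C(ℝ≥0, ℝ)) (r : ℝ≥0) ↦ w r) x m M d u (⟨fun r ↦ W ω r, hWc ω⟩ : C(ℝ≥0, ℝ)) =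
      crossingObs g W x m M d u ω :=
  crossingObs_congr_path rfl g x m M d u

/-! ### The start-clipped path `w - (w 0 - clip_{[-δ,δ]}(w 0))` -/

/-- Values of the **start-clipped path** `w - (w 0 - clip_{[-δ,δ]}(w 0))`: the path translated so
as to start at its initial value clipped to `[-δ, δ]` (it is `w` itself when `|w 0| ≤ δ`); a
technical device making the crossing functional regular on the whole path space. [folklore] -/
theorem cutStart_apply (δ : ℝ) (w : C(ℝ≥0, ℝ)) (r : ℝ≥0) :
    (w - ContinuousMap.const ℝ≥0 (w 0 - max (-δ) (min (w 0) δ))) r =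
      w r - (w 0 - max (-δ) (min (w 0) δ)) := rfl

/-- The start-clipped path starts at the clipped initial value. [folklore] -/
theorem cutStart_apply_zero (δ : ℝ) (w : C(ℝ≥0, ℝ)) :
    (w - ContinuousMap.const ℝ≥0 (w 0 - max (-δ) (min (w 0) δ))) 0 = max (-δ) (min (w 0) δ) := by
  rw [cutStart_apply]
  ring

/-- The start-clipped path starts in `[-δ, δ]` (`δ ≥ 0`). [folklore] -/
theorem abs_cutStart_zero_le {δ : ℝ} (hδ : 0 ≤ δ) (w : C(ℝ≥0, ℝ)) :
    |(w - ContinuousMap.const ℝ≥0 (w 0 - max (-δ) (min (w 0) δ))) 0| ≤ δ := by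
  rw [cutStart_apply_zero, abs_le]
  exact ⟨le_max_left _ _, max_le (by linarith) (min_le_right _ _)⟩

/-- A path started in `[-δ, δ]` is its own start-clipped path. [folklore] -/
theorem cutStart_of_abs_le {δ : ℝ} {w : C(ℝ≥0, ℝ)} (hw : |w 0| ≤ δ) :
    w - ContinuousMap.const ℝ≥0 (w 0 - max (-δ) (min (w 0) δ)) = w := by
  ext r
  rw [cutStart_apply]
  have h := abs_le.1 hw
  rw [min_eq_left h.2, max_eq_right h.1]
  ring

/-- Start-clipping is continuous on path space (compact-open topology). [folklore] -/
theorem continuous_cutStart (δ : ℝ) :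
    Continuous fun w : C(ℝ≥0, ℝ) ↦ w - ContinuousMap.const ℝ≥0 (w 0 - max (-δ) (min (w 0) δ)) := by
  refine continuous_id.sub (ContinuousMap.continuous_const'.comp ?_)
  exact (continuous_eval_const (0 : ℝ≥0)).sub
    (continuous_const.max ((continuous_eval_const (0 : ℝ≥0)).min continuous_const))

/-- For `0 ≤ δ < min (x₀ - m) (M - x₀)` every start-clipped path starts in the window. [folklore] -/
theorem cutStart_zero_mem_window {δ : ℝ} (hδ0 : 0 ≤ δ) (hδm : δ < x 0 - m) (hδM : δ < M - x 0)
    (w : C(ℝ≥0, ℝ)) :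
    (w - ContinuousMap.const ℝ≥0 (w 0 - max (-δ) (min (w 0) δ))) 0 ∈ Ioo (x 0 - M) (x 0 - m) := by
  have h := abs_le.1 (abs_cutStart_zero_le hδ0 w)
  constructor <;> linarith [h.1, h.2]

/-! ### The three sure regularity properties of the clipped crossing functional -/

/-- **Continuity in time** of the level-stopped crossing observable along a continuous driving path
started in the window (continuous kernel). [folklore] -/
theorem continuous_crossingObs_time_pt {Ω : Type*} {W : Ω → ℝ≥0 → ℝ} {ω : Ω}
    (hc : Continuous (W ω)) {ĝ : ℝ → ℝ} (hĝ : Continuous ĝ) (h : AdmissibleLevels x m M d)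
    (hw : W ω 0 ∈ Ioo (x 0 - M) (x 0 - m)) :
    Continuous fun u : ℝ≥0 ↦ crossingObs ĝ W x m M d u ω := by
  set ρ := levelTime W x m M d ω with hρ
  have hclock : Continuous fun u : ℝ≥0 ↦ (min (u : WithTop ℝ≥0) ρ).untopA :=
    continuous_untopA_min_coe ρ
  have hη : Continuous fun u : ℝ≥0 ↦ etaProc W x (min (u : WithTop ℝ≥0) ρ).untopA ω :=
    continuous_iff_continuousAt.2 fun u ↦
      ContinuousAt.comp' (f := fun u : ℝ≥0 ↦ (min (u : WithTop ℝ≥0) ρ).untopA) (x := u)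
        (continuousAt_etaProc_pt hc h hw (coe_untopA_min_le u ρ)) hclock.continuousAt
  exact hĝ.comp hη

/-- **Continuity in time of the clipped crossing functional along every path.** [folklore] -/
theorem continuous_crossingObs_cutStart_time {ĝ : ℝ → ℝ} (hĝ : Continuous ĝ)
    (h : AdmissibleLevels x m M d) {δ : ℝ} (hδ0 : 0 ≤ δ) (hδm : δ < x 0 - m) (hδM : δ < M - x 0)
    (w : C(ℝ≥0, ℝ)) :
    Continuous fun u : ℝ≥0 ↦ crossingObs ĝ (fun (w : C(ℝ≥0, ℝ)) (r : ℝ≥0) ↦ w r) x m M d u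
      (w - ContinuousMap.const ℝ≥0 (w 0 - max (-δ) (min (w 0) δ))) :=
  continuous_crossingObs_time_pt (W := fun (w : C(ℝ≥0, ℝ)) (r : ℝ≥0) ↦ w r)
    (ω := w - ContinuousMap.const ℝ≥0 (w 0 - max (-δ) (min (w 0) δ)))
    (w - ContinuousMap.const ℝ≥0 (w 0 - max (-δ) (min (w 0) δ))).continuous hĝ h
    (cutStart_zero_mem_window hδ0 hδm hδM w)

/-- A bounded kernel gives a bounded crossing observable. [folklore] -/
theorem norm_crossingObs_le_of_bound {Ω : Type*} {W : Ω → ℝ≥0 → ℝ} {ĝ : ℝ → ℝ} {B : ℝ}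
    (hB : ∀ y, |ĝ y| ≤ B) (u : ℝ≥0) (ω : Ω) : ‖crossingObs ĝ W x m M d u ω‖ ≤ B := by
  rw [Real.norm_eq_abs]
  exact hB _

section PathSpace

variable [MeasurableSpace C(ℝ≥0, ℝ)] [BorelSpace C(ℝ≥0, ℝ)]

/-- The coordinates of the start-clipped canonical process are strongly measurable. [folklore] -/
theorem stronglyMeasurable_cutStart_apply (δ : ℝ) (t : ℝ≥0) :
    StronglyMeasurable fun w : C(ℝ≥0, ℝ) ↦
      (w - ContinuousMap.const ℝ≥0 (w 0 - max (-δ) (min (w 0) δ))) t :=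
  ((continuous_eval_const t).comp (continuous_cutStart δ)).measurable.stronglyMeasurable

/-- **The clipped crossing functional is Borel measurable on path space** (continuous kernel,
admissible data, `0 ≤ δ < x₀ - m`). [folklore] -/
theorem measurable_crossingObs_cutStart {ĝ : ℝ → ℝ} (hĝ : Continuous ĝ) (h : AdmissibleLevels x m M d)
    {δ : ℝ} (hδ0 : 0 ≤ δ) (hδm : δ < x 0 - m) (u : ℝ≥0) :
    Measurable fun w : C(ℝ≥0, ℝ) ↦ crossingObs ĝ (fun (w : C(ℝ≥0, ℝ)) (r : ℝ≥0) ↦ w r) x m M d u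
      (w - ContinuousMap.const ℝ≥0 (w 0 - max (-δ) (min (w 0) δ))) := by
  set Wc : C(ℝ≥0, ℝ) → ℝ≥0 → ℝ := fun w r ↦
    (w - ContinuousMap.const ℝ≥0 (w 0 - max (-δ) (min (w 0) δ))) r with hWc
  have hsm : ∀ t, StronglyMeasurable fun w ↦ Wc w t := stronglyMeasurable_cutStart_apply δ
  have hWad : StronglyAdapted (Filtration.natural (fun t w ↦ Wc w t) hsm) (fun t w ↦ Wc w t) :=
    Filtration.stronglyAdapted_natural _
  have hcont : ∀ w, Continuous (Wc w) := fun w ↦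
    (w - ContinuousMap.const ℝ≥0 (w 0 - max (-δ) (min (w 0) δ))).continuous
  have hs : ∀ w, Wc w 0 < x 0 - m := fun w ↦
    lt_of_le_of_lt ((le_abs_self _).trans (abs_cutStart_zero_le hδ0 w)) hδm
  have hη := measurable_etaProc_stopped' hWad hcont h hs u
  have key : (fun w : C(ℝ≥0, ℝ) ↦ crossingObs ĝ (fun (w : C(ℝ≥0, ℝ)) (r : ℝ≥0) ↦ w r) x m M d u
      (w - ContinuousMap.const ℝ≥0 (w 0 - max (-δ) (min (w 0) δ)))) =
      fun w ↦ ĝ (etaProc Wc x (min (u : WithTop ℝ≥0) (levelTime Wc x m M d w)).untopA w) := by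
    funext w
    exact crossingObs_congr_path (W₁ := fun (w : C(ℝ≥0, ℝ)) (r : ℝ≥0) ↦ w r) (W₂ := Wc)
      (ω₁ := w - ContinuousMap.const ℝ≥0 (w 0 - max (-δ) (min (w 0) δ))) (ω₂ := w) rfl ĝ x m M d u
  rw [key]
  exact hĝ.measurable.comp hη

end PathSpace

/-! ### Uniform closeness on compact time intervals from joint continuity -/

/-- **Uniform closeness on a compact time interval from joint continuity** (compactness of
`[0, b]`): if `F` is jointly continuous at `(s, x₀)` for every `s < b'` and `b < b'`, then for every
`ε > 0`, points `x` near `x₀` satisfy `|F (s, x) - F (s, x₀)| < ε` for all `s ≤ b`. [folklore] -/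
theorem eventually_forall_abs_sub_lt_of_continuousAt {X : Type*} [TopologicalSpace X]
    {F : ℝ≥0 × X → ℝ} {x₀ : X} {b b' : ℝ≥0} (hbb' : b < b')
    (hF : ∀ s : ℝ≥0, s < b' → ContinuousAt F (s, x₀)) :
    ∀ ε : ℝ, 0 < ε → ∀ᶠ x in 𝓝 x₀, ∀ s : ℝ≥0, s ≤ b → |F (s, x) - F (s, x₀)| < ε := by
  intro ε hε
  have hP : ∀ s ∈ Icc (0 : ℝ≥0) b, ∀ᶠ z : X × ℝ≥0 in 𝓝 (x₀, s), |F (z.2, z.1) - F (z.2, x₀)| < ε := by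
    intro s hs
    have hc := hF s (lt_of_le_of_lt hs.2 hbb')
    have h1 : ∀ᶠ z : ℝ≥0 × X in 𝓝 (s, x₀), dist (F z) (F (s, x₀)) < ε / 2 :=
      Metric.tendsto_nhds.1 hc (ε / 2) (half_pos hε)
    have h2 : ∀ᶠ z : ℝ≥0 × X in 𝓝 (s, x₀), dist (F (z.1, x₀)) (F (s, x₀)) < ε / 2 := by
      have ht : Tendsto (fun z : ℝ≥0 × X ↦ (z.1, x₀)) (𝓝 (s, x₀)) (𝓝 (s, x₀)) :=
        (continuousAt_fst.prodMk continuousAt_const)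
      exact ht.eventually h1
    have h3 : ∀ᶠ z : ℝ≥0 × X in 𝓝 (s, x₀), |F (z.1, z.2) - F (z.1, x₀)| < ε := by
      filter_upwards [h1, h2] with z hz1 hz2
      rw [Real.dist_eq] at hz1 hz2
      calc |F (z.1, z.2) - F (z.1, x₀)| = |(F z - F (s, x₀)) - (F (z.1, x₀) - F (s, x₀))| := by
            congr 1; simp only [Prod.mk.eta]; ring
        _ ≤ |F z - F (s, x₀)| + |F (z.1, x₀) - F (s, x₀)| := abs_sub _ _
        _ < ε / 2 + ε / 2 := add_lt_add hz1 hz2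
        _ = ε := add_halves ε
    have hsw : Tendsto (fun z : X × ℝ≥0 ↦ (z.2, z.1)) (𝓝 (x₀, s)) (𝓝 (s, x₀)) :=
      (continuous_swap.tendsto (x₀, s))
    exact hsw.eventually h3
  have hev := isCompact_Icc.eventually_forall_of_forall_eventually
    (P := fun x s ↦ |F (s, x) - F (s, x₀)| < ε) hP
  filter_upwards [hev] with x hx s hs
  exact hx s ⟨zero_le, hs⟩

/-! ### Sequences of levels avoiding a countable set -/

/-- A nontrivial real interval is not exhausted by a countable set. [folklore] -/
theorem exists_mem_Ioo_notMem_of_countable {S : Set ℝ} (hS : S.Countable) {a a' : ℝ} (h : a < a') :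
    ∃ c, c ∈ Ioo a a' ∧ c ∉ S := by
  by_contra hnot
  push Not at hnot
  have hsub : Ioo a a' ⊆ S := fun c hc ↦ hnot c hc
  have h0 : volume (Ioo a a') = 0 := measure_mono_null hsub (hS.measure_zero volume)
  rw [Real.volume_Ioo] at h0
  have : 0 < ENNReal.ofReal (a' - a) := ENNReal.ofReal_pos.2 (by linarith)
  exact this.ne' h0

/-- **Inner approximation from above avoiding a countable set**: an antitone sequence in
`(a, a')`, off the countable `S`, converging to `a`. [folklore] -/
theorem exists_antitone_seq_notMem {S : Set ℝ} (hS : S.Countable) {a a' : ℝ} (h : a < a') :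
    ∃ c : ℕ → ℝ, Antitone c ∧ (∀ n, c n ∈ Ioo a a') ∧ (∀ n, c n ∉ S) ∧ Tendsto c atTop (𝓝 a) := by
  obtain ⟨u, hu, hmem, hlim⟩ := exists_seq_strictAnti_tendsto' h
  have hex : ∀ n, ∃ c, c ∈ Ioo (u (n + 1)) (u n) ∧ c ∉ S := fun n ↦
    exists_mem_Ioo_notMem_of_countable hS (hu (Nat.lt_succ_self n))
  choose c hc hcS using hex
  refine ⟨c, ?_, fun n ↦ ⟨(hmem (n + 1)).1.trans (hc n).1, (hc n).2.trans (hmem n).2⟩, hcS, ?_⟩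
  · refine antitone_nat_of_succ_le fun n ↦ ?_
    exact ((hc (n + 1)).2.trans (hc n).1).le
  · have h1 : Tendsto (fun n ↦ u (n + 1)) atTop (𝓝 a) := hlim.comp (tendsto_add_atTop_nat 1)
    exact tendsto_of_tendsto_of_tendsto_of_le_of_le h1 hlim (fun n ↦ (hc n).1.le)
      (fun n ↦ (hc n).2.le)

/-- **Inner approximation from below avoiding a countable set**: a monotone sequence in
`(a, a')`, off the countable `S`, converging to `a'`. [folklore] -/
theorem exists_monotone_seq_notMem {S : Set ℝ} (hS : S.Countable) {a a' : ℝ} (h : a < a') :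
    ∃ c : ℕ → ℝ, Monotone c ∧ (∀ n, c n ∈ Ioo a a') ∧ (∀ n, c n ∉ S) ∧ Tendsto c atTop (𝓝 a') := by
  obtain ⟨u, hu, hmem, hlim⟩ := exists_seq_strictMono_tendsto' h
  have hex : ∀ n, ∃ c, c ∈ Ioo (u n) (u (n + 1)) ∧ c ∉ S := fun n ↦
    exists_mem_Ioo_notMem_of_countable hS (hu (Nat.lt_succ_self n))
  choose c hc hcS using hex
  refine ⟨c, ?_, fun n ↦ ⟨(hmem n).1.trans (hc n).1, (hc n).2.trans (hmem (n + 1)).2⟩, hcS, ?_⟩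
  · refine monotone_nat_of_le_succ fun n ↦ ?_
    exact ((hc n).2.trans (hc (n + 1)).1).le
  · have h1 : Tendsto (fun n ↦ u (n + 1)) atTop (𝓝 a') := hlim.comp (tendsto_add_atTop_nat 1)
    exact tendsto_of_tendsto_of_tendsto_of_le_of_le hlim h1 (fun n ↦ (hc n).1.le)
      (fun n ↦ (hc n).2.le)

end MartingaleOfData

open MartingaleOfData in
/-- **Registered form** (glue sub-goal `martingaleOfData_measurable_crossingObs_cutStart` of
stmt-CriticalPhenomena-0746): the level-stopped crossing observable of the start-clipped canonical
driving process is a Borel measurable functional on driving-path space (continuous kernel,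
admissible data, `0 ≤ δ < x₀ - m`). [folklore] -/
theorem martingaleOfData_measurable_crossingObs_cutStart : ∀ [MeasurableSpace C(ℝ≥0, ℝ)] [BorelSpace C(ℝ≥0, ℝ)] {x : Fin 3 → ℝ} {m M d : ℝ} {ĝ : ℝ → ℝ}, Continuous ĝ → AdmissibleLevels x m M d → ∀ {δ : ℝ}, 0 ≤ δ → δ < x 0 - m → ∀ u : ℝ≥0, Measurable fun w : C(ℝ≥0, ℝ) ↦ crossingObs ĝ (fun (w : C(ℝ≥0, ℝ)) (r : ℝ≥0) ↦ w r) x m M d u (w - ContinuousMap.const ℝ≥0 (w 0 - max (-δ) (min (w 0) δ))) :=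
  fun hĝ h _ hδ0 hδm u ↦ measurable_crossingObs_cutStart hĝ h hδ0 hδm u

end Summit.CriticalPhenomena.CardyFormulaZ2.Cruxes.CardyRigidity.CrossingMartingale

end
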